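import Literature.NumberTheory.GaloisCohomology.Howard2004.CoeffTowerKolyvaginSystems
import HarnessLib

/-!
# Howard 2004, §1.6 / Rem. 1.2.4: cofinal sub-towers (re-indexing a tower setting)

Topic `NumberTheory/GaloisCohomology/Howard2004` (sequel to `CoeffTowerKolyvaginSystems`; companion of
`TowerMorphism`).  DEFINITIONS WITH BODIES and `rfl`/induction lemmas; no named fact, no instance,
no `sorry`.  Cell `pub/bsd-print-x9`, (T3-iii), x9-p1 LEAD ruling 2026-08-28 16:08Z (q2)(a):
«LEVEL REINDEXING IS NECESSARY — the target level-`k` ideal `(q_m, p^{k+1}) ⊆ Λ` contains only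
`𝔪_Λ^{(m+1)(k+1)}`, so a level map `N k → N′ k` does not exist in parallel indexing; it exists
`N (σ k) → N′ k` for `σ = σ_m` growing with `m`».

A compact `T` over a coefficient ring is presented by the tower of its finite levels
`T/𝔪^{e_k}T` (`AdicTower`, `CoeffTowerSetting`); ANY cofinal sub-sequence of levels presents the
same `T` («`H¹_F(K, T) = lim H¹_F(K, T/𝔪^kT)`», arXiv:1202.6340 p. 12 L29, is insensitive to the
cofinal system).  This file builds the sub-tower along `σ(0) = s₀`, `σ(k+1) = σ(k) + d(k)` — the
index sequence is DEFINED BY RECURSION (`idxSeq`) so that `N (σ (k+1))` is `N (σ k + d k)` by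
`rfl` and the iterated reductions typecheck without index transport:

* `idxSeq s₀ d`, `idxSeq_succ`, `le_idxSeq` (cofinal when `1 ≤ d k`);
* `AdicTower.redIter T k d : N (k + d) →ₗ[R] N k` (iterated reduction) with `redIter_succ`,
  `redIter_surjective`, `redIter_equivariant`; `AdicTower.reindex T s₀ d`;
* `CoeffTowerSetting.redRIter / rqIter / fsQIter` (iterated `redR`, `rq`, `fsQ`) with the
  compatibilities `rqIter_comp`, `rqIter_equivariant`;
* **`CoeffTowerSetting.reindex S s₀ d`** — the tower setting on the levels `σ k`: same `T` seen
  through the sub-tower, same `cd`, `jbar`, `Σ(F)`, `𝓛`, `T̄`, and the level data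
  `t / πbar / A / D / LD` read at `σ k`; `reindex_*` unfolding lemmas (`rfl`).

With `TowerMorphism`: the Eisenstein specialisation of STUB 2 is ONE
`Hom (Λ → Λ/(q_m)) (S_Λ.reindex s₀ d) (specSetting …).toCoeffTowerSetting`.  The push-forward of
Kolyvagin systems along `reindex` (`κ′ k := κ (σ k)`, `one′ k := one (σ k)`) and the invariance of
`LargePrimes` are the x9-p1 LEAD lineage's (`TowerMorphismPushforward.lean`).
BSD is not proved by any of this.
[cite: Howard2004HeegnerKolyvagin, §1.6 (arXiv p. 12, L29–33) and Rem. 1.2.4 (arXiv p. 7, L13–27)]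
-/

set_option autoImplicit false

noncomputable section

open Function NumberField IsDedekindDomain Field
open scoped NumberField ContRepresentation Classical TensorProduct

namespace Literature.NumberTheory.GaloisCohomology.Howard2004

open Literature.NumberTheory.GaloisRepresentations
open Literature.NumberTheory.GaloisRepresentations.DiscreteGaloisModule

/-! ## The index sequence, by recursion -/

/-- The index sequence `σ(0) = s₀`, `σ(k+1) = σ(k) + d(k)` of a cofinal system of levels (by
recursion, so that `σ (k+1)` is `σ k + d k` definitionally). [cite: Howard2004HeegnerKolyvagin, §1.6 (arXiv p. 12, L29–33), cofinal levels `T/𝔪^kT`] -/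
def idxSeq (s₀ : ℕ) (d : ℕ → ℕ) : ℕ → ℕ
  | 0 => s₀
  | k + 1 => idxSeq s₀ d k + d k

/-- `σ 0 = s₀`. [cite: Howard2004HeegnerKolyvagin, §1.6 (arXiv p. 12, L29–33), cofinal levels `T/𝔪^kT`] -/
@[simp] theorem idxSeq_zero (s₀ : ℕ) (d : ℕ → ℕ) : idxSeq s₀ d 0 = s₀ := rfl

/-- `σ (k+1) = σ k + d k`. [cite: Howard2004HeegnerKolyvagin, §1.6 (arXiv p. 12, L29–33), cofinal levels `T/𝔪^kT`] -/
@[simp] theorem idxSeq_succ (s₀ : ℕ) (d : ℕ → ℕ) (k : ℕ) :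
    idxSeq s₀ d (k + 1) = idxSeq s₀ d k + d k := rfl

/-- `σ k ≤ σ (k+1)`. [cite: Howard2004HeegnerKolyvagin, §1.6 (arXiv p. 12, L29–33), cofinal levels `T/𝔪^kT`] -/
theorem idxSeq_le_succ (s₀ : ℕ) (d : ℕ → ℕ) (k : ℕ) : idxSeq s₀ d k ≤ idxSeq s₀ d (k + 1) :=
  Nat.le_add_right _ _

/-- `σ` is monotone. [cite: Howard2004HeegnerKolyvagin, §1.6 (arXiv p. 12, L29–33), cofinal levels `T/𝔪^kT`] -/
theorem idxSeq_monotone (s₀ : ℕ) (d : ℕ → ℕ) : Monotone (idxSeq s₀ d) :=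
  monotone_nat_of_le_succ (idxSeq_le_succ s₀ d)

/-- `σ` is cofinal when every increment is positive: `s₀ + k ≤ σ k`. [cite: Howard2004HeegnerKolyvagin, §1.6 (arXiv p. 12, L29–33), cofinal levels `T/𝔪^kT`] -/
theorem le_idxSeq (s₀ : ℕ) (d : ℕ → ℕ) (hd : ∀ k, 1 ≤ d k) (k : ℕ) : s₀ + k ≤ idxSeq s₀ d k := by
  induction k with
  | zero => simp
  | succ k ih =>
    rw [idxSeq_succ]
    have := hd k
    omega

/-! ## Iterated reductions of a tower and the sub-tower -/

section Tower

variable {K : Type} [Field K] {R : Type} [CommRing R] [IsLocalRing R]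
  {N : ℕ → Type} [∀ k, AddCommGroup (N k)] [∀ k, TopologicalSpace (N k)]
  [∀ k, DiscreteTopology (N k)] [∀ k, Module R (N k)]

namespace AdicTower

/-- **Iterated reduction** `T_{k+d} → T_k` (`red_k ∘ ⋯ ∘ red_{k+d-1}`).
[cite: Howard2004HeegnerKolyvagin, §1.6 (arXiv p. 12, L29–33)] -/
def redIter (T : AdicTower K R N) (k : ℕ) : ∀ d : ℕ, N (k + d) →ₗ[R] N k
  | 0 => LinearMap.id
  | d + 1 => (redIter T k d).comp (T.red (k + d))

/-- `redIter k 0 = id`. [cite: Howard2004HeegnerKolyvagin, §1.6 (arXiv p. 12)] -/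
@[simp] theorem redIter_zero (T : AdicTower K R N) (k : ℕ) (x : N (k + 0)) : T.redIter k 0 x = x := rfl

/-- `redIter k (d+1) = redIter k d ∘ red_{k+d}`. [cite: Howard2004HeegnerKolyvagin, §1.6 (arXiv p. 12)] -/
theorem redIter_succ (T : AdicTower K R N) (k d : ℕ) (x : N (k + d + 1)) :
    T.redIter k (d + 1) x = T.redIter k d (T.red (k + d) x) := rfl

/-- Iterated reductions are surjective. [cite: Howard2004HeegnerKolyvagin, §1.6 (arXiv p. 12)] -/
theorem redIter_surjective (T : AdicTower K R N) (k : ℕ) : ∀ d, Function.Surjective (T.redIter k d)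
  | 0 => fun x => ⟨x, rfl⟩
  | d + 1 => (redIter_surjective T k d).comp (T.red_surjective (k + d))

/-- Iterated reductions are `Γ_K`-equivariant. [cite: Howard2004HeegnerKolyvagin, §1.6 (arXiv p. 12)] -/
theorem redIter_equivariant (T : AdicTower K R N) (k : ℕ) :
    ∀ (d : ℕ) (σ : absoluteGaloisGroup K) (x : N (k + d)),
      T.redIter k d (T.ρ (k + d) σ x) = T.ρ k σ (T.redIter k d x)
  | 0, _, _ => rfl
  | d + 1, σ, x => by
    change T.redIter k d (T.red (k + d) (T.ρ (k + d + 1) σ x)) =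
      T.ρ k σ (T.redIter k d (T.red (k + d) x))
    rw [T.red_equivariant, redIter_equivariant T k d]

/-- **The cofinal sub-tower** along `σ = idxSeq s₀ d`: levels `T_{σ k}`, reductions the iterated
ones. [cite: Howard2004HeegnerKolyvagin, §1.6 (arXiv p. 12, L29–33)] -/
def reindex (T : AdicTower K R N) (s₀ : ℕ) (d : ℕ → ℕ) :
    AdicTower K R (fun k => N (idxSeq s₀ d k)) where
  ρ k := T.ρ (idxSeq s₀ d k)
  hlin _ := T.hlin _
  killed _ := T.killed _
  red k := T.redIter (idxSeq s₀ d k) (d k)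
  red_surjective _ := T.redIter_surjective _ _
  red_equivariant _ σ x := T.redIter_equivariant _ _ σ x

/-- The level-`k` module of the sub-tower is `T_{σ k}`. [cite: Howard2004HeegnerKolyvagin, §1.6 (arXiv p. 12)] -/
@[simp] theorem reindex_ρ (T : AdicTower K R N) (s₀ : ℕ) (d : ℕ → ℕ) (k : ℕ) :
    (T.reindex s₀ d).ρ k = T.ρ (idxSeq s₀ d k) := rfl

/-- The reduction of the sub-tower is the iterated reduction. [cite: Howard2004HeegnerKolyvagin, §1.6 (arXiv p. 12)] -/
@[simp] theorem reindex_red (T : AdicTower K R N) (s₀ : ℕ) (d : ℕ → ℕ) (k : ℕ) :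
    (T.reindex s₀ d).red k = T.redIter (idxSeq s₀ d k) (d k) := rfl

end AdicTower

end Tower

/-! ## Re-indexing a tower setting -/

section Setting

variable {p : ℕ} [Fact p.Prime] {K : Type} [Field K] [NumberField K]
  {R : Type} [CommRing R] [IsLocalRing R] [Algebra ℤ_[p] R]
  {N : ℕ → Type} [∀ k, AddCommGroup (N k)] [∀ k, TopologicalSpace (N k)]
  [∀ k, DiscreteTopology (N k)] [∀ k, Module R (N k)]
  {Rk : ℕ → Type} [∀ k, CommRing (Rk k)] [∀ k, IsLocalRing (Rk k)] [∀ k, TopologicalSpace (Rk k)]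
  [∀ k, DiscreteTopology (Rk k)] [∀ k, Algebra ℤ_[p] (Rk k)] [∀ k, Algebra R (Rk k)]
  [∀ k, Module (Rk k) (N k)] [∀ k, IsScalarTower R (Rk k) (N k)]
  {Nbar : Type} [AddCommGroup Nbar] [TopologicalSpace Nbar] [DiscreteTopology Nbar]
  [∀ k, Module (Rk k) Nbar]
  {Nq : ℕ → Finset (HeightOneSpectrum (𝓞 K)) → Type} [∀ k n, AddCommGroup (Nq k n)]
  [∀ k n, TopologicalSpace (Nq k n)] [∀ k n, DiscreteTopology (Nq k n)]
  [∀ k n, Module (Rk k) (Nq k n)] [∀ k n, Module R (Nq k n)]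
  [∀ k n, IsScalarTower R (Rk k) (Nq k n)]

namespace CoeffTowerSetting

/-- Iterated reduction of the level rings `R_{k+d} → R_k`. [cite: Howard2004HeegnerKolyvagin, §1.6 (arXiv p. 11, L33–38)] -/
def redRIter (S : CoeffTowerSetting p K R N Rk Nbar Nq) (k : ℕ) : ∀ d : ℕ, Rk (k + d) →+* Rk k
  | 0 => RingHom.id _
  | d + 1 => (redRIter S k d).comp (S.redR (k + d))

/-- Iterated reduction of the Kolyvagin quotients `T^{(k+d)}/I_n → T^{(k)}/I_n`.
[cite: Howard2004HeegnerKolyvagin, Def. 1.2.3 / §1.6 (arXiv p. 7 L1–12, p. 11 L49–50)] -/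
def rqIter (S : CoeffTowerSetting p K R N Rk Nbar Nq) (k : ℕ) (n : Finset (HeightOneSpectrum (𝓞 K))) :
    ∀ d : ℕ, Nq (k + d) n →ₗ[R] Nq k n
  | 0 => LinearMap.id
  | d + 1 => (rqIter S k n d).comp (S.rq (k + d) n)

/-- `rqIter k n (d+1) = rqIter k n d ∘ rq_{k+d}`. [cite: Howard2004HeegnerKolyvagin, §1.6 (arXiv p. 11)] -/
theorem rqIter_succ (S : CoeffTowerSetting p K R N Rk Nbar Nq) (k : ℕ) (n : Finset (HeightOneSpectrum (𝓞 K)))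
    (d : ℕ) (y : Nq (k + d + 1) n) : S.rqIter k n (d + 1) y = S.rqIter k n d (S.rq (k + d) n y) := rfl

/-- The iterated quotient reductions are compatible with the presentations and the iterated
reductions of the tower: `rqIter (π y) = π (redIter y)`. [cite: Howard2004HeegnerKolyvagin, §1.6 (arXiv p. 11, L49–50)] -/
theorem rqIter_comp (S : CoeffTowerSetting p K R N Rk Nbar Nq) (k : ℕ) (n : Finset (HeightOneSpectrum (𝓞 K))) :
    ∀ (d : ℕ) (x : N (k + d)),
      S.rqIter k n d ((S.LD (k + d)).π n x) = (S.LD k).π n (S.T.redIter k d x)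
  | 0, _ => rfl
  | d + 1, x => by
    change S.rqIter k n d (S.rq (k + d) n ((S.LD (k + d + 1)).π n x)) =
      (S.LD k).π n (S.T.redIter k d (S.T.red (k + d) x))
    rw [S.rq_comp, rqIter_comp S k n d]

/-- The iterated quotient reductions are `Γ_K`-equivariant. [cite: Howard2004HeegnerKolyvagin, §1.6 (arXiv p. 11, L49–50)] -/
theorem rqIter_equivariant (S : CoeffTowerSetting p K R N Rk Nbar Nq) (k : ℕ)
    (n : Finset (HeightOneSpectrum (𝓞 K))) :
    ∀ (d : ℕ) (g : absoluteGaloisGroup K) (y : Nq (k + d) n),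
      S.rqIter k n d ((S.LD (k + d)).ρq n g y) = (S.LD k).ρq n g (S.rqIter k n d y)
  | 0, _, _ => rfl
  | d + 1, g, y => by
    change S.rqIter k n d (S.rq (k + d) n ((S.LD (k + d + 1)).ρq n g y)) =
      (S.LD k).ρq n g (S.rqIter k n d (S.rq (k + d) n y))
    rw [S.rq_equivariant, rqIter_equivariant S k n d]

/-- Iterated maps of the singular quotients along the reductions.
[cite: Howard2004HeegnerKolyvagin, Def. 1.2.3, display (ks relations) (arXiv p. 6, L126–140)] -/
def fsQIter (S : CoeffTowerSetting p K R N Rk Nbar Nq) (k : ℕ) (n : Finset (HeightOneSpectrum (𝓞 K)))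
    (v : HeightOneSpectrum (𝓞 K)) :
    ∀ d : ℕ, SingularQuotient (GaloisRep.toLocal v ((S.LD (k + d)).ρq n)) →+
      SingularQuotient (GaloisRep.toLocal v ((S.LD k).ρq n))
  | 0 => AddMonoidHom.id _
  | d + 1 => (fsQIter S k n v d).comp (S.fsQ (k + d) n v)

/-- **The re-indexed tower setting** along `σ = idxSeq s₀ d`: the same compact `T` seen through the
cofinal sub-tower `T_{σ k}`, the same `τ`, `jbar`, `Σ(F)`, `𝓛`, `T̄`, and the level data read at
`σ k`; reductions iterated. [cite: Howard2004HeegnerKolyvagin, §1.6 (arXiv p. 12, L29–33) and Rem. 1.2.4 (arXiv p. 7, L13–27)] -/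
def reindex (S : CoeffTowerSetting p K R N Rk Nbar Nq) (s₀ : ℕ) (d : ℕ → ℕ) :
    CoeffTowerSetting p K R (fun k => N (idxSeq s₀ d k)) (fun k => Rk (idxSeq s₀ d k)) Nbar
      (fun k n => Nq (idxSeq s₀ d k) n) where
  e k := S.e (idxSeq s₀ d k)
  T := S.T.reindex s₀ d
  cd := S.cd
  jbar := S.jbar
  Sigma := S.Sigma
  L := S.L
  t k := S.t (idxSeq s₀ d k)
  ρbar := S.ρbar
  πbar k := S.πbar (idxSeq s₀ d k)
  A k := S.A (idxSeq s₀ d k)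
  D k := S.D (idxSeq s₀ d k)
  redR k := S.redRIter (idxSeq s₀ d k) (d k)
  LD k := S.LD (idxSeq s₀ d k)
  rq k n := S.rqIter (idxSeq s₀ d k) n (d k)
  rq_comp _ n x := S.rqIter_comp _ n _ x
  rq_equivariant _ n g y := S.rqIter_equivariant _ n _ g y
  fsQ k n v := S.fsQIter (idxSeq s₀ d k) n v (d k)

/-- Unfolding: the tower of the re-indexed setting. [cite: Howard2004HeegnerKolyvagin, §1.6 (arXiv p. 12)] -/
@[simp] theorem reindex_T (S : CoeffTowerSetting p K R N Rk Nbar Nq) (s₀ : ℕ) (d : ℕ → ℕ) :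
    (S.reindex s₀ d).T = S.T.reindex s₀ d := rfl

/-- Unfolding: the level triples. [cite: Howard2004HeegnerKolyvagin, §1.6 (arXiv p. 11, L33–38)] -/
@[simp] theorem reindex_t (S : CoeffTowerSetting p K R N Rk Nbar Nq) (s₀ : ℕ) (d : ℕ → ℕ) (k : ℕ) :
    (S.reindex s₀ d).t k = S.t (idxSeq s₀ d k) := rfl

/-- Unfolding: the level data. [cite: Howard2004HeegnerKolyvagin, Def. 1.2.3 (arXiv p. 7)] -/
@[simp] theorem reindex_LD (S : CoeffTowerSetting p K R N Rk Nbar Nq) (s₀ : ℕ) (d : ℕ → ℕ) (k : ℕ) :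
    (S.reindex s₀ d).LD k = S.LD (idxSeq s₀ d k) := rfl

/-- Unfolding: `jbar`, `𝓛`, `Σ(F)`, `cd` are unchanged. [cite: Howard2004HeegnerKolyvagin, Rem. 1.2.4 (arXiv p. 7)] -/
theorem reindex_jbar (S : CoeffTowerSetting p K R N Rk Nbar Nq) (s₀ : ℕ) (d : ℕ → ℕ) :
    (S.reindex s₀ d).jbar = S.jbar ∧ (S.reindex s₀ d).L = S.L ∧ (S.reindex s₀ d).Sigma = S.Sigma ∧
      (S.reindex s₀ d).cd = S.cd :=
  ⟨rfl, rfl, rfl, rfl⟩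

/-- Unfolding: the quotient reductions of the re-indexed setting are the iterated ones.
[cite: Howard2004HeegnerKolyvagin, §1.6 (arXiv p. 11, L49–50)] -/
@[simp] theorem reindex_rq (S : CoeffTowerSetting p K R N Rk Nbar Nq) (s₀ : ℕ) (d : ℕ → ℕ) (k : ℕ)
    (n : Finset (HeightOneSpectrum (𝓞 K))) :
    (S.reindex s₀ d).rq k n = S.rqIter (idxSeq s₀ d k) n (d k) := rfl

/-- `𝓛₀` of the sub-tower contains `𝓛₀` of the tower (fewer levels to be unramified at).
[cite: Howard2004HeegnerKolyvagin, §1.2 (arXiv p. 6, L54–56)] -/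
theorem degreeTwoPrimes_subset_reindex (S : CoeffTowerSetting p K R N Rk Nbar Nq) (s₀ : ℕ)
    (d : ℕ → ℕ) : S.T.degreeTwoPrimes p ⊆ (S.reindex s₀ d).T.degreeTwoPrimes p := by
  intro v hv
  simp only [AdicTower.degreeTwoPrimes, Set.mem_iInter] at hv ⊢
  exact fun k => hv _

/-- `𝓛_s` of the sub-tower contains `𝓛_s` of the tower. [cite: Howard2004HeegnerKolyvagin, Def. 1.2.1 (arXiv p. 6, L63–68)] -/
theorem kolyvaginPrimes_subset_reindex (S : CoeffTowerSetting p K R N Rk Nbar Nq) (s₀ : ℕ)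
    (d : ℕ → ℕ) (s : ℕ) : S.T.kolyvaginPrimes p s ⊆ (S.reindex s₀ d).T.kolyvaginPrimes p s := by
  rintro v ⟨h0, h1, h2⟩
  exact ⟨degreeTwoPrimes_subset_reindex S s₀ d h0, h1, fun k σ hσ x => h2 _ σ hσ x⟩

end CoeffTowerSetting

end Setting

end Literature.NumberTheory.GaloisCohomology.Howard2004

end
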